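import Literature.NumberTheory.EllipticCurves.ShaRestriction
import Literature.NumberTheory.DiophantineGeometry.LocalReductionFiniteBadPlacesProofs
import HarnessLib

/-!
# Period, index and potential `Ш` (Clark–Sharif 2010, Theorem 3 from its parts)

Trunk T-ELLARITH (`NumberTheory/EllipticCurves`). D-0014 decomposition file for the named fact
`Literature.Barriers.BirchSwinnertonDyer.ClarkSharif2010_thm3`
(`Literature/Barriers/BirchSwinnertonDyer/DescentDefectUnbounded`): P. L. Clark, S. Sharif,
*Period, index and potential. III*, Algebra Number Theory 4 (2010) 151–174 (arXiv:0811.3019),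
**Theorem 3**: for an elliptic curve `E` over a global field `K` and an integer `P > 1` prime to
the characteristic, "For any positive integer `r`, there exists a degree `P` field extension `L/K`
such that `Ш(L, E)` contains at least `r` elements of order `P`."

What is printed (§1.1, p. 3). "The period of `η ∈ H¹(K, E)` is its order in the group. […] The
index of `η` is the gcd over all degrees `[L : K]` of field extensions `L/K` such that the
restriction of `η` to `H¹(L, E)` is trivial. […] we denote the image of a class `η ∈ H¹(K, E)`
under the local restriction map `H¹(K, E) → H¹(K_v, E)` by `η_v`. […] By the support of a class we
mean the finite set of `v ∈ Σ_K` such that `η_v ≠ 0`. The classes `η` with empty support form a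
subgroup `Ш(K, E)`."  **Theorem 2** (p. 3): "Let `E/K` be an elliptic curve and `S_K ⊂ Σ_K` a
finite set of places of `K`. There exists an infinite sequence `{η_i}_{i=0}^∞` of elements of
`H¹(K, E)` such that: `η_0 = 0`. For all `v ∈ S_K` and all `i ∈ ℕ`, `res_v η_i = 0`. For all
`i, j ∈ ℕ` with `i ≠ j`, `η_i - η_j` has period `P` and index `P²`."  **§3.7, Proof of Theorem 3**
(p. 13): "Recall the following two 'classical' instances of period equals index. (i) (Lang–Tate
[LT]) `F` is the completion of a global field at a place `v`, `E = Jac(C)` has good reduction,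
and `v` does not divide the period of `C`; and (ii) (Cassels) `F` is global and `C ∈ Ш(F, E)`.
[…] they show also that a finite extension field `F'/F` splits a genus one curve `C/F` if and
only if the period `P` of `C` divides the relative ramification index `e(F'/F)`. […] Take `S` to
be the union of the infinite places, the finite places which divide `P` and the places of bad
reduction for `E`. Let `{η_i}` be the sequence of classes constructed in Theorem 2. […] let
`S_r = ⋃_{i=1}^r supp(η_i)`. We have `S_r ∩ S = ∅` […] For each `v_i ∈ S_r`, let `L_i/K_{v_i}`
be a totally ramified extension of degree `P`. There exists a degree `P` global extension
`L = L(r)` of `K` such that for all `v_i ∈ S_r`, `L ⊗_K K_{v_i} ≅ L_i` [footnote: a standard weak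
approximation / Krasner's Lemma argument, cf. [WCI]]. By the results of Lang and Tate cited
above, `η_i|_L` is locally trivial. Moreover, since `η_i = η_i - η_0` has index `P²` and `L/K` is
a degree `P` extension, `I(η_i|_L) ≥ P`. But on the other hand, by (ii) above,
`I(η_i|_L) = P(η_i|_L) ∣ P(η_i) = P`, so for all `i`, `1 ≤ i ≤ r`, `η_i|_L` has period and index
equal to `P`. The only worry is that their restrictions are not distinct. But suppose that
`η_i|_L = η_j|_L`. Then `η_i - η_j` would lie in the kernel of `res_L`. This would imply that
`I(η_i - η_j) ∣ P`, which we have arranged not to be the case."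

This file
* defines the **splitting degrees** and the **index** `I(η)` of a class `η ∈ H¹(K, E)`
  (`Literature.NumberTheory.EllipticCurves.splittingDegrees`, `Literature.NumberTheory.EllipticCurves.index`; the period is `addOrderOf η`) and its (finite) **support**
  (`Literature.NumberTheory.EllipticCurves.support`), on the tree's `H¹(K, E) = WeierstrassCurve.galH1`, local kernels
  `WeierstrassCurve.localRestrictionKer` and restriction `Literature.resBaseChange W L : H¹(K, E) →
  H¹(L, E_L)` (`ShaRestriction`); API: `index_dvd_of_mem_splittingDegrees`,
  `le_index_of_forall_dvd`, `index_zero`, the tower rule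
  `mul_mem_splittingDegrees_of_mem_resBaseChange`, and the local conditions of a restricted class
  above a place where the class is already trivial (`resBaseChange_mem_localRestrictionKer_adic`,
  `resBaseChange_mem_localRestrictionKer_infinite`);
* vendors the parts of the printed proof as named facts, each as printed: `ClarkSharif2010_thm2`
  (Theorem 2), `LangTate1958_split_of_dvd_ramificationIdx` (Lang–Tate, in the form (i) is applied
  in §3.7), `Cassels1962_index_eq_period_of_mem_sha` ((ii): `I = P` on `Ш`),
  `ClarkSharif2010_exists_totallyRamified` (the degree-`P` extension with prescribed totally
  ramified completions) and `finite_support` (§1.1: the support is finite);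
* **proves Theorem 3 over any number field from these parts** (`ClarkSharif2010_thm3_of_parts`,
  the §3.7 deduction verbatim); the specialisation to `K = ℚ` closing
  `Literature.Barriers.BirchSwinnertonDyer.ClarkSharif2010_thm3` is in
  `Literature/Barriers/BirchSwinnertonDyer/DescentDefectUnboundedProofs`.

Design notes. `index` is the greatest natural number dividing every splitting degree
(`sSup`; equal to the gcd of the splitting degrees as soon as there is one, and to the junk value
`0` if `η` split over no finite extension, which does not happen); all facts are stated over
number fields (the paper: global fields, `P` prime to the characteristic) in the tree's universe
discipline `K L : Type u`.

## References

* P. L. Clark, S. Sharif, Algebra Number Theory 4 (2010) 151–174, §1.1, Theorems 2–3, §3.7 with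
  footnote 3 (`ClarkSharif2010`; arXiv:0811.3019 read in full).
* S. Lang, J. Tate, *Principal homogeneous spaces over abelian varieties*, Amer. J. Math. 80
  (1958) 659–684 (`LangTate1958`; NOT read — cited through the printed reports ClarkSharif2010
  §3.7 (i) and Clark2006Crelle §3).
* J. W. S. Cassels, *Arithmetic on curves of genus 1. IV. Proof of the Hauptvermutung*, J. reine
  angew. Math. 211 (1962) 95–112 (`Cassels1962ArithmeticIV`; NOT read — cited through
  ClarkSharif2010 §1.3/§3.7 (ii); a printed proof of the statement used is Clark2006Crelle,
  Prop. 6 with Prop. 5(a), read).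
* P. L. Clark, *There are genus one curves of every index over every number field*, J. reine
  angew. Math. 594 (2006) 201–206, §2 Props. 5–6, §3 (`Clark2006Crelle`; arXiv:math/0411413 read).
* P. L. Clark, *The period–index problem in WC-groups I*, J. Number Theory 114 (2005) 193–208,
  §2 (`Clark2005WCI`; arXiv:math/0406131 read).
-/

noncomputable section

open scoped Classical

open NumberField IsDedekindDomain

universe u

namespace Literature.NumberTheory.EllipticCurves

/-! ### Splitting degrees and the index of a class of `H¹(K, E)` -/

section Index

variable {K : Type u} [Field K] (W : WeierstrassCurve K)

/-- The **splitting degrees** of a class `η ∈ H¹(K, E)`: the degrees `[M : K]` of the finite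
field extensions `M/K` over which `η` becomes trivial, i.e. such that `η` lies in the kernel of
the restriction `H¹(K, E) → H¹(M, E)` (the tree's `WeierstrassCurve.localRestrictionKer W M`,
equivalently `Literature.resBaseChange W M η = 0`, `Literature.NumberTheory.EllipticCurves.mem_ker_resBaseChange_iff`). Clark–Sharif, §1.1:
"degrees `[L : K]` of field extensions `L/K` such that the restriction of `η` to `H¹(L, E)` is
trivial". [cite: ClarkSharif2010, §1.1] -/
def splittingDegrees (η : W.galH1) : Set ℕ :=
  {d | ∃ (M : Type u) (_ : Field M) (_ : Algebra K M) (_ : FiniteDimensional K M),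
    Module.finrank K M = d ∧ η ∈ W.localRestrictionKer M}

/-- The **index** `I(η)` of a class `η ∈ H¹(K, E)`: "the gcd over all degrees `[L : K]` of field
extensions `L/K` such that the restriction of `η` to `H¹(L, E)` is trivial" (in terms of the
torsor `C`, the least degree of a `K`-rational divisor on `C`). Formally the greatest natural
number dividing every splitting degree; this is the gcd of `splittingDegrees W η` whenever that
set is nonempty (every class splits over some finite extension), and the junk value `0`
(`sSup` of an unbounded set of naturals) otherwise. The **period** of `η` is its order
`addOrderOf η`. [cite: ClarkSharif2010, §1.1] -/
def index (η : W.galH1) : ℕ :=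
  sSup {g : ℕ | ∀ d ∈ splittingDegrees W η, g ∣ d}

variable {W}

/-- Splitting degrees are degrees of finite field extensions, hence positive. [folklore] -/
theorem pos_of_mem_splittingDegrees {η : W.galH1} {d : ℕ} (hd : d ∈ splittingDegrees W η) :
    0 < d := by
  obtain ⟨M, _, _, _, rfl, -⟩ := hd
  exact Module.finrank_pos

/-- The zero class splits already over `K` itself: `1` is a splitting degree of `0`. [folklore] -/
theorem one_mem_splittingDegrees_zero : 1 ∈ splittingDegrees W (0 : W.galH1) :=
  ⟨K, inferInstance, inferInstance, inferInstance, Module.finrank_self K, zero_mem _⟩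

variable (W)

/-- **The index divides every splitting degree** (it is a common divisor of the splitting
degrees: the set of common divisors contains `1` and is bounded by any splitting degree, so its
supremum belongs to it). [cite: ClarkSharif2010, §1.1] -/
theorem index_dvd_of_mem_splittingDegrees {η : W.galH1} {d : ℕ} (hd : d ∈ splittingDegrees W η) :
    index W η ∣ d := by
  have hne : ({g : ℕ | ∀ d ∈ splittingDegrees W η, g ∣ d}).Nonempty := ⟨1, fun _ _ ↦ one_dvd _⟩
  have hbdd : BddAbove {g : ℕ | ∀ d ∈ splittingDegrees W η, g ∣ d} :=
    ⟨d, fun g hg ↦ Nat.le_of_dvd (pos_of_mem_splittingDegrees hd) (hg d hd)⟩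
  exact Nat.sSup_mem hne hbdd d hd

/-- **Every common divisor of the splitting degrees is at most the index**, as soon as the index
is not the junk value `0`. [cite: ClarkSharif2010, §1.1] -/
theorem le_index_of_forall_dvd {η : W.galH1} (h0 : index W η ≠ 0) {g : ℕ}
    (hg : ∀ d ∈ splittingDegrees W η, g ∣ d) : g ≤ index W η := by
  have hbdd : BddAbove {g : ℕ | ∀ d ∈ splittingDegrees W η, g ∣ d} := by
    by_contra h
    exact h0 (Nat.sSup_of_not_bddAbove h)
  exact le_csSup hbdd hg

/-- The index of the zero class is `1`. [folklore] -/
theorem index_zero : index W (0 : W.galH1) = 1 :=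
  Nat.dvd_one.mp (index_dvd_of_mem_splittingDegrees W one_mem_splittingDegrees_zero)

/-- If `η` dies in `H¹(L, E_L)` for a finite extension `L/K` then `[L : K]` is a splitting degree
of `η`. [cite: ClarkSharif2010, §1.1] -/
theorem finrank_mem_splittingDegrees_of_resBaseChange_eq_zero (L : Type u) [Field L] [Algebra K L]
    [FiniteDimensional K L] {η : W.galH1} (h : resBaseChange W L η = 0) :
    Module.finrank K L ∈ splittingDegrees W η :=
  ⟨L, inferInstance, inferInstance, inferInstance, rfl, (mem_ker_resBaseChange_iff W L η).mp h⟩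

/-- **Splitting degrees multiply along towers.** If the restriction `η|_L ∈ H¹(L, E_L)` of `η`
to a finite extension `L/K` splits over a finite extension `M/L` of degree `d`, then `η` splits
over `M/K`, of degree `[L : K] · d`: the vanishing of `η` in `H¹(M, E)` along `K → M` and of
`η|_L` in `H¹(M, E_L)` along `L → M` are the same condition
(`Literature.NumberTheory.EllipticCurves.mem_localRestrictionKer_iff_resBaseChange_mem`). Used in §3.7 as "since `η_i` has index
`P²` and `L/K` is a degree `P` extension, `I(η_i|_L) ≥ P`". [cite: ClarkSharif2010, §3.7] -/
theorem mul_mem_splittingDegrees_of_mem_resBaseChange (L : Type u) [Field L] [Algebra K L]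
    [FiniteDimensional K L] {η : W.galH1} {d : ℕ}
    (hd : d ∈ splittingDegrees (W.baseChange L) (resBaseChange W L η)) :
    Module.finrank K L * d ∈ splittingDegrees W η := by
  obtain ⟨M, _, _, _, rfl, hM⟩ := hd
  letI : Algebra K M := ((algebraMap L M).comp (algebraMap K L)).toAlgebra
  haveI : IsScalarTower K L M := IsScalarTower.of_algebraMap_eq fun _ ↦ rfl
  haveI : FiniteDimensional K M := Module.Finite.trans L M
  exact ⟨M, inferInstance, inferInstance, inferInstance, (Module.finrank_mul_finrank K L M).symm,
    (mem_localRestrictionKer_iff_resBaseChange_mem W η).mpr hM⟩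

end Index

/-! ### Support of a class; local conditions of a restricted class above a trivial place -/

section Support

variable {K : Type u} [Field K] [NumberField K] (W : WeierstrassCurve K)

/-- The (finite part of the) **support** of a class `η ∈ H¹(K, E)` over a number field `K`: the
finite places `v` of `K` at which `η` is NOT locally trivial, `η_v ≠ 0` in `H¹(K_v, E)`
(`η ∉ W.localRestrictionKer K_v`). Clark–Sharif, §1.1: "By the support of a class we mean the
finite set of `v ∈ Σ_K` such that `η_v ≠ 0`." (The paper's support also records infinite
places; only finite places are needed below.) [cite: ClarkSharif2010, §1.1] -/
def support (η : W.galH1) : Set (HeightOneSpectrum (𝓞 K)) :=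
  {v | η ∉ W.localRestrictionKer (v.adicCompletion K)}

/-- Membership in the support: `v ∈ supp(η)` iff `η_v ≠ 0`. [cite: ClarkSharif2010, §1.1] -/
theorem mem_support_iff (η : W.galH1) (v : HeightOneSpectrum (𝓞 K)) :
    v ∈ support W η ↔ η ∉ W.localRestrictionKer (v.adicCompletion K) :=
  Iff.rfl

/-- The zero class has empty support. [folklore] -/
theorem support_zero : support W (0 : W.galH1) = ∅ :=
  Set.eq_empty_of_forall_notMem fun _ h ↦ h (zero_mem _)

variable (L : Type u) [Field L] [NumberField L] [Algebra K L]

/-- **Local condition at a finite place above a trivial place.** If `η ∈ H¹(K, E)` is locally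
trivial at the finite place `v` of `K` below the finite place `w` of `L` (`v = w ∩ 𝓞 K`), then
`η|_L ∈ H¹(L, E_L)` is locally trivial at `w`: `η ↦ 0` in `H¹(K_v, E)` gives `η ↦ 0` in
`H¹(L_w, E)` along `K_v → L_w` (`Literature.NumberTheory.EllipticCurves.localRestrictionKer_le_of_tower`,
`Literature.NumberTheory.EllipticCurves.adicCompletionMap`), which is the local condition for `η|_L` at `w`
(`Literature.NumberTheory.EllipticCurves.mem_localRestrictionKer_iff_resBaseChange_mem`). The finite-place half of
`Literature.NumberTheory.EllipticCurves.resBaseChange_mem_sha`, stated placewise. [folklore] -/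
theorem resBaseChange_mem_localRestrictionKer_adic {η : W.galH1} (w : HeightOneSpectrum (𝓞 L))
    (hη : η ∈ W.localRestrictionKer ((w.under (𝓞 K)).adicCompletion K)) :
    resBaseChange W L η ∈ (W.baseChange L).localRestrictionKer (w.adicCompletion L) := by
  let v : HeightOneSpectrum (𝓞 K) := w.under (𝓞 K)
  haveI : w.asIdeal.LiesOver v.asIdeal := ⟨rfl⟩
  letI : Algebra (v.adicCompletion K) (w.adicCompletion L) :=
    (adicCompletionMap (K := K) L v w).toAlgebra
  haveI : IsScalarTower K (v.adicCompletion K) (w.adicCompletion L) :=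
    IsScalarTower.of_algebraMap_eq fun x ↦ (adicCompletionMap_coe (K := K) L v w x).symm
  exact (mem_localRestrictionKer_iff_resBaseChange_mem W η).mp
    (localRestrictionKer_le_of_tower W (E := v.adicCompletion K) hη)

omit [NumberField K] [NumberField L] in
/-- **Local condition at an infinite place above a trivial place.** If `η ∈ H¹(K, E)` is locally
trivial at the infinite place `v = w ∘ (K → L)` of `K` below the infinite place `w` of `L`, then
`η|_L` is locally trivial at `w` (along `K_v → L_w`, Mathlib's `NumberField.LiesOver` completion
algebra). The infinite-place half of `Literature.NumberTheory.EllipticCurves.resBaseChange_mem_sha`, stated placewise. [folklore] -/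
theorem resBaseChange_mem_localRestrictionKer_infinite {η : W.galH1} (w : InfinitePlace L)
    (hη : η ∈ W.localRestrictionKer (w.comap (algebraMap K L)).Completion) :
    resBaseChange W L η ∈ (W.baseChange L).localRestrictionKer w.Completion := by
  let v : InfinitePlace K := w.comap (algebraMap K L)
  haveI : w.1.LiesOver v.1 := ⟨rfl⟩
  haveI : IsScalarTower K L w.Completion := IsScalarTower.of_algebraMap_eq fun x ↦ by
    apply NumberField.InfinitePlace.Completion.ext
    rw [NumberField.InfinitePlace.Completion.algebraMap_toCompletion,
      NumberField.InfinitePlace.Completion.algebraMap_toCompletion,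
      UniformSpace.Completion.algebraMap_def, UniformSpace.Completion.algebraMap_def,
      IsScalarTower.algebraMap_apply K L (WithAbs w.1)]
  letI : Algebra v.Completion w.Completion := NumberField.LiesOver.instAlgebraCompletion
  haveI : IsScalarTower K v.Completion w.Completion :=
    NumberField.LiesOver.instIsScalarTowerCompletion
  exact (mem_localRestrictionKer_iff_resBaseChange_mem W η).mp
    (localRestrictionKer_le_of_tower W (E := v.Completion) hη)

end Support

/-! ### The parts of the printed proof (named facts) -/

/-- **The support of a class is finite** (Clark–Sharif, §1.1: "By the support of a class we mean
the finite set of `v ∈ Σ_K` such that `η_v ≠ 0`"; Clark 2005, §2: "For each `η_i` […] there is a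
finite set of places `v` of `K` such that `η_i` remains nonzero in the completion `K_v`"). For an
elliptic curve `E` over a number field `K` and `η ∈ H¹(K, E)`, the set of finite places `v` with
`η_v ≠ 0` is finite. (Proof in the literature: `η` is inflated from a finite extension `M/K`; at a
place of good reduction unramified in `M` an unramified class is trivial by Lang's theorem.)
[cite: ClarkSharif2010, §1.1] [cite: Clark2005WCI, §2] -/
def finite_support : Prop :=
  ∀ {K : Type u} [Field K] [NumberField K] (W : WeierstrassCurve K) [W.IsElliptic] (η : W.galH1),
    (support W η).Finite

/-- **Clark–Sharif 2010, Theorem 2.** "Let `E/K` be an elliptic curve and `S_K ⊂ Σ_K` a finite set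
of places of `K`. There exists an infinite sequence `{η_i}_{i=0}^∞` of elements of `H¹(K, E)`
such that: `η_0 = 0`. For all `v ∈ S_K` and all `i ∈ ℕ`, `res_v η_i = 0`. For all `i, j ∈ ℕ`
with `i ≠ j`, `η_i - η_j` has period `P` and index `P²`." Here `K` is a global field and `P` a
positive integer not divisible by its characteristic (§1.1); vendored over a number field `K`
for every `P > 0`, the finite set of places being given by its finite part `S` and its infinite
part `T`, `res_v η = 0` spelled `η ∈ W.localRestrictionKer K_v`, the period as `addOrderOf` and
the index as `Literature.NumberTheory.EllipticCurves.index`. (The heart of the paper: theta groups and O'Neil's period-index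
obstruction map `Δ_P : H¹(K, E[P]) → Br(K)`, Lichtenbaum–Tate duality, corestriction from the
`P*`-division field and two applications of the Chebotarev density theorem, §§2–3.6.)
[cite: ClarkSharif2010, Theorem 2] -/
def ClarkSharif2010_thm2 : Prop :=
  ∀ {K : Type u} [Field K] [NumberField K] (W : WeierstrassCurve K) [W.IsElliptic] (P : ℕ),
    0 < P → ∀ (S : Finset (HeightOneSpectrum (𝓞 K))) (T : Finset (InfinitePlace K)),
      ∃ η : ℕ → W.galH1, η 0 = 0 ∧
        (∀ i, ∀ v ∈ S, η i ∈ W.localRestrictionKer (v.adicCompletion K)) ∧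
        (∀ i, ∀ w ∈ T, η i ∈ W.localRestrictionKer w.Completion) ∧
        ∀ i j, i ≠ j → addOrderOf (η i - η j) = P ∧ index W (η i - η j) = P ^ 2

/-- **Lang–Tate 1958, as applied in Clark–Sharif §3.7 (i).** Printed: "(i) (Lang–Tate [LT]) `F` is
the completion of a global field at a place `v`, `E = Jac(C)` has good reduction, and `v` does
not divide the period of `C` [then `P = I`]; […] the result of Lang and Tate […] is also more
precise: they show also that a finite extension field `F'/F` splits a genus one curve `C/F` if
and only if the period `P` of `C` divides the relative ramification index `e(F'/F)`. This will be
used in the proof. […] By the results of Lang and Tate cited above, `η_i|_L` is locally trivial";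
Clark 2006, §3: "if `E/K_v` is an elliptic curve over a `v`-adic field with good reduction and
`p^a` is prime to the order of the residue field, then an element of `H¹(K_v, E)` of period `p^a`
also has index `p^a` and moreover is split by a local extension field `L_w/K_v` if and only if
`p^a` divides the ramification index `e(L_w/K_v)`."  Vendored in the form the "if" direction is
applied in §3.7: for an elliptic curve `E` over a number field `K`, a finite extension `L/K`, a
class `η ∈ H¹(K, E)` killed by `P > 0`, a finite place `v` of `K` of good reduction for `E` with
`v ∤ P`, and a place `w` of `L` above `v` whose ramification index `e(w|v)` (`= e(L_w/K_v)`) is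
divisible by `P`: the restriction `η|_L` is locally trivial at `w` — equivalently
(`Literature.NumberTheory.EllipticCurves.mem_localRestrictionKer_iff_resBaseChange_mem`) `η_v` splits over `L_w`. (The period of
`η_v` divides `P`, hence is prime to `v` and divides `e(L_w/K_v)`; by primary decomposition it
suffices to split each prime-power component.)
[cite: ClarkSharif2010, §3.7 (i)] [cite: Clark2006Crelle, §3 (reporting LangTate1958)] -/
def LangTate1958_split_of_dvd_ramificationIdx : Prop :=
  ∀ {K : Type u} [Field K] [NumberField K] (W : WeierstrassCurve K) [W.IsElliptic]
    (L : Type u) [Field L] [NumberField L] [Algebra K L] (η : W.galH1) (P : ℕ), 0 < P → P • η = 0 →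
    ∀ (v : HeightOneSpectrum (𝓞 K)), W.HasGoodReductionAt v → (P : 𝓞 K) ∉ v.asIdeal →
      ∀ (w : HeightOneSpectrum (𝓞 L)) [w.asIdeal.LiesOver v.asIdeal],
        P ∣ w.asIdeal.ramificationIdx (𝓞 K) →
          resBaseChange W L η ∈ (W.baseChange L).localRestrictionKer (w.adicCompletion L)

/-- **Cassels 1962 (Arithmetic on curves of genus 1, IV): period equals index on `Ш`**, as used in
Clark–Sharif §3.7 (ii): "(ii) (Cassels) `F` is global and `C ∈ Ш(F, E)` [then `P = I`]"; §1.3: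
"Cassels showed that `I = P` for classes with empty support". A printed proof of exactly this
statement: Clark 2006, Prop. 6 ("Let `C/K` be a genus one curve over a number field whose
corresponding class `η` lies in `𝒦(K, Jac(C))`. Then every rational divisor class on `C` admits
a rational divisor. In particular, the period and index of `η` are equal.") with Prop. 5(a)
(`Ш(K, E) ⊂ 𝒦(K, E)`). Formal statement: for an elliptic curve `E` over a number field `K` and
`η ∈ Ш(E/K)`, `Literature.index W η = addOrderOf η`.
[cite: ClarkSharif2010, §3.7 (ii) and §1.3 (reporting Cassels1962ArithmeticIV)]
[cite: Clark2006Crelle, Prop. 6 with Prop. 5(a)] -/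
def Cassels1962_index_eq_period_of_mem_sha : Prop :=
  ∀ {K : Type u} [Field K] [NumberField K] (W : WeierstrassCurve K) [W.IsElliptic] (η : W.galH1),
    η ∈ W.sha → index W η = addOrderOf η

/-- **The degree-`P` extension with prescribed totally ramified completions** (Clark–Sharif §3.7:
"For each `v_i ∈ S_r`, let `L_i/K_{v_i}` be a totally ramified extension of degree `P`. There
exists a degree `P` global extension `L = L(r)` of `K` such that for all `v_i ∈ S_r`,
`L ⊗_K K_{v_i} ≅ L_i`", footnote 3: "This is a standard weak approximation / Krasner's Lemma
argument: c.f. [WCI]"). Formal statement: for a number field `K`, a finite set `T` of finite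
places and `P > 0` there is a number field `L ⊇ K` with `[L : K] = P` such that every `v ∈ T` is
totally ramified in `L`: every place `w` of `L` above `v` has `e(w|v) = P` (`= [L : K]`, so that
`w` is the unique place above `v`, with residue degree `1`, i.e. `L ⊗_K K_v = L_w` is a totally
ramified field extension of `K_v` of degree `P`). [cite: ClarkSharif2010, §3.7 with footnote 3] -/
def ClarkSharif2010_exists_totallyRamified : Prop :=
  ∀ {K : Type u} [Field K] [NumberField K] (T : Finset (HeightOneSpectrum (𝓞 K))) (P : ℕ),
    0 < P → ∃ (L : Type u) (_ : Field L) (_ : NumberField L) (_ : Algebra K L),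
      Module.finrank K L = P ∧
        ∀ v ∈ T, ∀ (w : HeightOneSpectrum (𝓞 L)) [w.asIdeal.LiesOver v.asIdeal],
          w.asIdeal.ramificationIdx (𝓞 K) = P

/-! ### Theorem 3 from its parts (§3.7) -/

section Thm3

variable {K : Type u} [Field K] [NumberField K] (W : WeierstrassCurve K) [W.IsElliptic]

/-- **Clark–Sharif 2010, Theorem 3, over a number field, deduced from Theorem 2, Lang–Tate,
Cassels, the ramified extension and the finiteness of supports, exactly as in §3.7.** For an
elliptic curve `E` over a number field `K`, `P > 1` and `r`, there is an extension `L/K` of degree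
`[L : K] = P` and `r` distinct elements of `Ш(E_L/L)` of order exactly `P`. Proof (§3.7): `S :=`
bad places `∪ {v ∣ P}` (finite: `WeierstrassCurve.finite_badPlaces_holds`, `Ideal.finite_factors`)
and all infinite places; `η` from Theorem 2; `T := ⋃_{1 ≤ i ≤ r} supp(η_i)` (finite by
`finite_support`); `L` from `ClarkSharif2010_exists_totallyRamified`. Then `η_i|_L ∈ Ш(E_L/L)`:
above a place outside the support by `resBaseChange_mem_localRestrictionKer_adic`/`_infinite`,
above `v ∈ supp(η_i)` — of good reduction and prime to `P` since `supp(η_i) ∩ S = ∅` — by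
Lang–Tate. `P(η_i|_L) ∣ P(η_i) = P` (`addOrderOf_map_dvd`); every splitting degree `d` of `η_i|_L`
gives the splitting degree `P · d` of `η_i`, divisible by `I(η_i) = P²`, so `P ∣ d` and
`P ≤ I(η_i|_L) = P(η_i|_L)` (Cassels), whence `P(η_i|_L) = P`; and `η_i|_L = η_j|_L` for `i ≠ j`
would make `P = [L : K]` a splitting degree of `η_i - η_j`, of index `P² ∤ P`.
[cite: ClarkSharif2010, Theorem 3 and §3.7] -/
theorem ClarkSharif2010_thm3_of_parts (h2 : ClarkSharif2010_thm2.{u})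
    (hLT : LangTate1958_split_of_dvd_ramificationIdx.{u})
    (hC : Cassels1962_index_eq_period_of_mem_sha.{u})
    (hX : ClarkSharif2010_exists_totallyRamified.{u}) (hF : finite_support.{u})
    {P : ℕ} (hP : 1 < P) (r : ℕ) :
    ∃ (L : Type u) (_ : Field L) (_ : NumberField L) (_ : Algebra K L),
      Module.finrank K L = P ∧
        ∃ S : Finset ↥((W.baseChange L).sha), S.card = r ∧ ∀ x ∈ S, addOrderOf x = P := by
  have hP0 : 0 < P := lt_trans zero_lt_one hP
  -- `S` = bad places ∪ places dividing `P` (finite places), and all infinite places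
  have hbad : (W.badPlaces (𝓞 K)).Finite := W.finite_badPlaces_holds (𝓞 K)
  have hPne : Ideal.span {(P : 𝓞 K)} ≠ ⊥ := by
    rw [Ne, Ideal.span_singleton_eq_bot]
    exact_mod_cast hP0.ne'
  have hdiv : {v : HeightOneSpectrum (𝓞 K) | v.asIdeal ∣ Ideal.span {(P : 𝓞 K)}}.Finite :=
    Ideal.finite_factors hPne
  obtain ⟨η, hη0, hηS, hηT, hηP⟩ := h2 W P hP0 (hbad.toFinset ∪ hdiv.toFinset) Finset.univ
  have hord : ∀ i, 0 < i → addOrderOf (η i) = P := fun i hi ↦ by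
    simpa [hη0] using (hηP i 0 hi.ne').1
  have hidx : ∀ i, 0 < i → index W (η i) = P ^ 2 := fun i hi ↦ by
    simpa [hη0] using (hηP i 0 hi.ne').2
  -- `T` = the supports of `η 1, …, η r`; `L/K` of degree `P`, totally ramified above `T`
  set T : Finset (HeightOneSpectrum (𝓞 K)) :=
    (Finset.range r).biUnion fun i ↦ (hF W (η (i + 1))).toFinset with hTdef
  obtain ⟨L, _, _, _, hdeg, hram⟩ := hX T P hP0
  haveI : FiniteDimensional K L := Module.Finite.of_restrictScalars_finite ℚ K L
  haveI : (W.baseChange L).IsElliptic := by rw [WeierstrassCurve.baseChange]; infer_instance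
  -- `η i|_L ∈ Ш(E_L/L)` for `1 ≤ i ≤ r`
  have hsha : ∀ i < r, resBaseChange W L (η (i + 1)) ∈ (W.baseChange L).sha := by
    intro i hi
    rw [WeierstrassCurve.mem_sha_iff]
    refine ⟨fun w ↦ ?_, fun w ↦ ?_⟩
    · by_cases hv : η (i + 1) ∈ W.localRestrictionKer ((w.under (𝓞 K)).adicCompletion K)
      · exact resBaseChange_mem_localRestrictionKer_adic W L w hv
      · -- `v = w ∩ 𝓞 K` lies in the support: good reduction, prime to `P`, `e(w|v) = P`
        set v : HeightOneSpectrum (𝓞 K) := w.under (𝓞 K) with hvdef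
        haveI : w.asIdeal.LiesOver v.asIdeal := ⟨rfl⟩
        have hvT : v ∈ T := by
          rw [hTdef, Finset.mem_biUnion]
          exact ⟨i, Finset.mem_range.mpr hi, (hF W (η (i + 1))).mem_toFinset.mpr hv⟩
        have hvS : v ∉ hbad.toFinset ∪ hdiv.toFinset := fun h ↦ hv (hηS (i + 1) v h)
        have hgood : W.HasGoodReductionAt v := by
          by_contra h
          exact hvS (Finset.mem_union_left _ (hbad.mem_toFinset.mpr h))
        have hPv : (P : 𝓞 K) ∉ v.asIdeal := fun h ↦
          hvS (Finset.mem_union_right _ (hdiv.mem_toFinset.mpr (Ideal.dvd_span_singleton.mpr h)))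
        have hPη : P • η (i + 1) = 0 := by
          rw [← hord (i + 1) i.succ_pos]
          exact addOrderOf_nsmul_eq_zero (η (i + 1))
        exact hLT W L (η (i + 1)) P hP0 hPη v hgood hPv w ((hram v hvT w).symm ▸ dvd_rfl)
    · exact resBaseChange_mem_localRestrictionKer_infinite W L w
        (hηT (i + 1) _ (Finset.mem_univ _))
  -- the `r` classes `η 1|_L, …, η r|_L`
  let x : Fin r → ↥((W.baseChange L).sha) := fun i ↦ ⟨resBaseChange W L (η (i + 1)), hsha i i.2⟩
  have hxord : ∀ i, addOrderOf (x i) = P := by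
    intro i
    rw [← AddSubgroup.addOrderOf_coe]
    change addOrderOf (resBaseChange W L (η (i + 1))) = P
    have hdvd : addOrderOf (resBaseChange W L (η (i + 1))) ∣ P := by
      rw [← hord (i + 1) (Nat.succ_pos i)]
      exact addOrderOf_map_dvd _ _
    have hne : addOrderOf (resBaseChange W L (η (i + 1))) ≠ 0 := fun h ↦ by
      rw [h] at hdvd
      exact hP0.ne' (Nat.eq_zero_of_zero_dvd hdvd)
    have hIL : index (W.baseChange L) (resBaseChange W L (η (i + 1))) =
        addOrderOf (resBaseChange W L (η (i + 1))) :=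
      hC (W.baseChange L) _ (hsha i i.2)
    have hPdvd : ∀ d ∈ splittingDegrees (W.baseChange L) (resBaseChange W L (η (i + 1))),
        P ∣ d := by
      intro d hd
      have h := index_dvd_of_mem_splittingDegrees W
        (mul_mem_splittingDegrees_of_mem_resBaseChange W L hd)
      rw [hidx (i + 1) (Nat.succ_pos i), hdeg, pow_two] at h
      exact Nat.dvd_of_mul_dvd_mul_left hP0 h
    have hle : P ≤ addOrderOf (resBaseChange W L (η (i + 1))) := by
      rw [← hIL]
      exact le_index_of_forall_dvd (W.baseChange L) (by rwa [hIL]) hPdvd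
    exact le_antisymm (Nat.le_of_dvd hP0 hdvd) hle
  have hxinj : Function.Injective x := by
    intro i j hij
    by_contra hne
    have hne' : (i : ℕ) + 1 ≠ (j : ℕ) + 1 := fun h ↦ hne (Fin.ext (Nat.succ_injective h))
    have h0 : resBaseChange W L (η (i + 1) - η (j + 1)) = 0 := by
      rw [map_sub, sub_eq_zero]
      exact congrArg Subtype.val hij
    have hdv := index_dvd_of_mem_splittingDegrees W
      (finrank_mem_splittingDegrees_of_resBaseChange_eq_zero W L h0)
    rw [(hηP _ _ hne').2, hdeg, pow_two] at hdv
    have hle : P * P ≤ P * 1 := by simpa using Nat.le_of_dvd hP0 hdv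
    exact absurd (Nat.le_of_mul_le_mul_left hle hP0) (not_le.mpr hP)
  refine ⟨L, inferInstance, inferInstance, inferInstance, hdeg, Finset.univ.image x, ?_, ?_⟩
  · rw [Finset.card_image_of_injective _ hxinj, Finset.card_univ, Fintype.card_fin]
  · intro y hy
    obtain ⟨i, -, rfl⟩ := Finset.mem_image.mp hy
    exact hxord i

end Thm3

end Literature.NumberTheory.EllipticCurves

end
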